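import Summits.FinalStateConjecture.FinalStateConjecture.Theses.KerrnessPropagates
import Literature.Geometry.Lorentzian.BoostedKerrSchildDecay
import Literature.Geometry.Lorentzian.MultiCentreRadiationZone

/-!
# Route `KerrnessPropagates`, crux `KerrBasinCapture` (stmt-FinalStateConjecture-17646), line `registered`
# (skeleton `Cruxes/KerrBasinCapture/Lines/birth.lean`, lead rev 5) — stub `stub_farFieldFlatness`

**Far-field flatness of a hand-over slab, given uniform boosted Kerr–Schild decay.**  In the
slab-transfer step of the line `registered` the lead needs, at the points `z` of a hand-over slab
`{x⁰ = τ}` that are far from ALL holes (every rest-frame Kerr–Schild radius `r_l(z) ≥ ρ ≥ ρ₀`), that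
the chart metric is `(ε + C/ρ)`-close to `η` in `Cᵏ`, with `C, ρ₀` depending only on the margins.
The slab hypotheses give `Cᵏ`-flatness `≤ ε` directly only on the far zone
`Far = {x⁰ = τ, r_j > r₀ j ∀ j, r_j ≥ R j − 1 ∀ j}`; at any other admissible point some radius has
`r_l(z) < R l − 1`, so `z` lies in the near disc `Near_l = {x⁰ = τ, r_j > r₀ j ∀ j, r_l ≤ R l}` of
hole `l`, where the deviation from the boosted Kerr–Schild field `g_l = boostedKerrBilin Λ_l c_l M_l a_l`
is `ε`-small in `Cᵏ`, while `g_l − η` itself has all derivatives `≤ C / r_l(z) ≤ C/ρ` by the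
uniform decay hypothesis `(G)` (proved separately as `stub_uniformBoostedKerrDecay`).

Proof of `stub_farFieldFlatness`.  Case `z ∈ Far`: pointwise extraction from the `Cᵏ` sup norm
(`enorm_iteratedFDeriv_le_supCkENorm`).  Case `z ∈ Near_l`: the two reference backgrounds
`B_l = ⟨U, g_l, x⁰, r_l⟩` and `Minkowski.backgroundOn U` live on the SAME chart domain `U ∋ z`, so
near `z` the two extended deviations of the same chart map differ by `g_l − η`
(`Spacetime.deviationExtend_backgroundOn_eventuallyEq_model` with the identity inclusion); both
summands are smooth at `z` (`Spacetime.contDiffAt_deviationExtend_model`,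
`contDiffAt_boostedKerrBilin`, `contDiffAt_boostedKsPert`, the radius at `z` being `≥ ρ₀ > 0`), so
`Dᵐ` splits (`fun_iteratedFDeriv_add_apply`) and the two bounds add.

References: M. Dafermos, G. Holzegel, I. Rodnianski, M. Taylor, arXiv:2104.08222, §1 (unweighted
`Cᵏ` deviation norms on slabs); R. P. Kerr, A. Schild (1965), §3 (smoothness and `O(M/r)` fall-off
of the Kerr–Schild form).
-/

open scoped BigOperators Topology Manifold Classical Matrix InnerProductSpace ContinuousMap ContDiff
open Filter Set Function TopologicalSpace
open Literature.Geometry.Lorentzian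

-- D-0017: single-problem summit, `Summit.<S>.<S>.…` by design.
set_option linter.dupNamespace false

namespace Summit.FinalStateConjecture.FinalStateConjecture.Theorems.KerrnessPropagates.KerrBasinCapture

/-- Pointwise extraction from a `Cᵏ` sup-norm bound: `‖Dᵐ f (x)‖ ≤ ε` for `m ≤ k` at every point of
the set (`enorm_iteratedFDeriv_le_supCkENorm`; the order-`m` version of the `C⁰` extraction used by
`stub_largeNearZones`). [folklore] -/
private theorem norm_iteratedFDeriv_le_of_supCkENorm_le {G : Type*} [NormedAddCommGroup G]
    [NormedSpace ℝ G] {S : Set E4} {k m : ℕ} (hm : m ≤ k) {f : E4 → G} {ε : ℝ} (hε : 0 ≤ ε)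
    (h : supCkENorm S k f ≤ ENNReal.ofReal ε) {x : E4} (hx : x ∈ S) :
    ‖iteratedFDeriv ℝ m f x‖ ≤ ε := by
  have h1 := (enorm_iteratedFDeriv_le_supCkENorm hm hx f).trans h
  rwa [← ofReal_norm, ENNReal.ofReal_le_ofReal_iff hε] at h1

/-- **Stub B — far-field flatness given uniform decay** (registered stub of crux
stmt-FinalStateConjecture-17646, line `registered`).  Assume the uniform boosted Kerr–Schild decay
`(G)`: for every order `k` and margins `(m₀, χ, L₀)` there are `C, R₀ > 0` with
`‖Dᵐ (boostedKerrBilin Λ c M a − η)(x)‖ ≤ C / r` for `m ≤ k`, `r = r_a(Λ⁻¹(x − c)) ≥ R₀`, uniformly over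
`m₀ ≤ M ≤ m₀⁻¹`, `|a| ≤ χM`, `‖Λ‖ ≤ L₀`, all `c`.  Then for every vacuum development, order `k` and
margins there are `C, ρ₀ > 0` such that for every multi-Kerr configuration in the margins, every
hand-over slab `{x⁰ = τ}` of accuracy `ε ≥ 0` (near discs `ε`-close to the boosted Kerr–Schild
fields in `Cᵏ`, far zone `ε`-flat in `Cᵏ`) and every admissible slab point `z` all of whose
rest-frame radii are `≥ ρ ≥ ρ₀`, the deviation of the chart metric from `η` satisfies
`‖Dᵐ (Φ^* g − η)(z)‖ ≤ ε + C/ρ` for `m ≤ k` (far zone: directly; near disc of hole `l`: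
`(Φ^* g − η) = (Φ^* g − g_l) + (g_l − η)` near `z` and `(G)` at radius `r_l(z) ≥ ρ`). [folklore] -/
theorem stub_farFieldFlatness : (∀ (k : ℕ) (m₀ χ L₀ : ℝ), 0 < m₀ → ∃ C R₀ : ℝ, 0 < R₀ ∧ ∀ (M a : ℝ) (Λ : ↥lorentzGroup) (c : E4), m₀ ≤ M → M ≤ m₀⁻¹ → |a| ≤ χ * M → (∀ v : E4, ‖(Λ : E4 ≃L[ℝ] E4) v‖ ≤ L₀ * ‖v‖) → ∀ x : E4, R₀ ≤ Kerr.radius a (poincareInv Λ c x) → ∀ m ≤ k, ‖iteratedFDeriv ℝ m (fun y ↦ boostedKerrBilin Λ c M a y - Minkowski.bilin) x‖ ≤ C / Kerr.radius a (poincareInv Λ c x)) → ∀ k : ℕ, ∀ (X : Type) [TopologicalSpace X] [ChartedSpace E3 X] [IsManifold (𝓡 3) (⊤ : ℕ∞) X] [T2Space X] [SecondCountableTopology X] [ConnectedSpace X] (D : InitialDataSet (𝓡 3) X) (𝒟 : VacuumCauchyDevelopment D) (N₀ : ℕ) (m₀ χ μ v₀ L₀ : ℝ), 0 < m₀ → ∃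 C ρ₀ : ℝ, 0 < ρ₀ ∧ ∀ (N : ℕ) (M a r₀ : Fin N → ℝ) (mo : Fin N → ↥lorentzGroup × E4), (N ≤ N₀ ∧ (∀ i, m₀ ≤ M i ∧ M i ≤ m₀⁻¹ ∧ |a i| ≤ χ * M i ∧ Kerr.rMinus (M i) (a i) + μ ≤ r₀ i ∧ r₀ i + μ ≤ Kerr.rPlus (M i) (a i) ∧ ∀ v : E4, ‖((mo i).1 : E4 ≃L[ℝ] E4) v‖ ≤ L₀ * ‖v‖) ∧ (∀ i j, i ≠ j → v₀ ≤ ‖(((mo i).1 : E4 ≃L[ℝ] E4) (E4.basisVector 0) 0)⁻¹ • E4.spatial (((mo i).1 : E4 ≃L[ℝ] E4) (E4.basisVector 0)) - (((mo j).1 : E4 ≃L[ℝ] E4) (E4.basisVector 0) 0)⁻¹ • E4.spatial (((mo j).1 : E4 ≃L[ℝ] E4) (E4.basisVector 0))‖)) → ∀ (ε τ : ℝ) (R : Fin N → ℝ) (U : Opens E4) (Φ : U → 𝒟.carrier), 0 ≤ ε → ((∀ i, r₀ i + 1 ≤ R i) ∧ ContMDiff 𝓘(ℝ, E4) (𝓡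 4) (⊤ : ℕ∞) Φ ∧ Topology.IsOpenEmbedding Φ ∧ {x : E4 | x 0 = τ ∧ (∀ j, r₀ j < Kerr.radius (a j) (poincareInv (mo j).1 (mo j).2 x))} ⊆ (U : Set E4) ∧ range Φ ⊆ 𝒟.metric.causalFuture 𝒟.timeOrientation (range 𝒟.embed) ∧ 𝒟.metric.IsAchronal 𝒟.timeOrientation (Φ '' {x : ↥U | (x : E4) 0 = τ}) ∧ (∀ i, supCkENorm {x : E4 | x 0 = τ ∧ (∀ j, r₀ j < Kerr.radius (a j) (poincareInv (mo j).1 (mo j).2 x)) ∧ Kerr.radius (a i) (poincareInv (mo i).1 (mo i).2 x) ≤ R i} k (𝒟.toSpacetime.deviationExtend ⟨U, boostedKerrBilin (mo i).1 (mo i).2 (M i) (a i), fun x ↦ x 0, fun x ↦ Kerr.radius (a i) (poincareInv (mo i).1 (mo i).2 x)⟩ Φ) ≤ ENNReal.ofReal ε) ∧ supCkENorm {x : E4 | x 0 = τ ∧ (∀ j, r₀ j < Kerr.radius (a j) (poincareInv (mo j).1 (mo j).2 x)) ∧ ∀ j, R j - 1 ≤ Kerr.radius (a j) (poincareInv (mo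 j).1 (mo j).2 x)} k (𝒟.toSpacetime.deviationExtend (Minkowski.backgroundOn U) Φ) ≤ ENNReal.ofReal ε ∧ (∀ x : ↥U, x.1 0 = τ → (∀ j, R j - 1 ≤ Kerr.radius (a j) (poincareInv (mo j).1 (mo j).2 x.1)) → 𝒟.timeOrientation.IsFutureDirected (mfderiv 𝓘(ℝ, E4) (𝓡 4) Φ x (E4.basisVector 0)))) → ∀ z : E4, z 0 = τ → (∀ l, r₀ l < Kerr.radius (a l) (poincareInv (mo l).1 (mo l).2 z)) → ∀ ρ : ℝ, ρ₀ ≤ ρ → (∀ l, ρ ≤ Kerr.radius (a l) (poincareInv (mo l).1 (mo l).2 z)) → ∀ m ≤ k, ‖iteratedFDeriv ℝ m (𝒟.toSpacetime.deviationExtend (Minkowski.backgroundOn U) Φ) z‖ ≤ ε + C / ρ := by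
  intro hG k X _ _ _ _ _ _ D 𝒟 N₀ m₀ χ μ v₀ L₀ hm₀
  obtain ⟨C, R₀, hR₀, hdec⟩ := hG k m₀ χ L₀ hm₀
  refine ⟨max C 0, R₀, hR₀, ?_⟩
  intro N M a r₀ mo hcfg ε τ R U Φ hε hslab z hz0 hzin ρ hρ₀ hρ m hm
  obtain ⟨-, hmarg, -⟩ := hcfg
  obtain ⟨-, hΦs, -, hUsub, -, -, hnear, hfar, -⟩ := hslab
  have hρpos : 0 < ρ := hR₀.trans_le hρ₀
  have hC0 : 0 ≤ max C 0 := le_max_right _ _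
  have hCρ : 0 ≤ max C 0 / ρ := div_nonneg hC0 hρpos.le
  by_cases hA : ∀ j, R j - 1 ≤ Kerr.radius (a j) (poincareInv (mo j).1 (mo j).2 z)
  · -- `z` lies in the far zone, where the chart is `ε`-flat in `Cᵏ` by hypothesis
    have h1 := norm_iteratedFDeriv_le_of_supCkENorm_le hm hε hfar ⟨hz0, hzin, hA⟩
    linarith
  · -- `z` lies in the near disc of some hole `l`
    push Not at hA
    obtain ⟨l, hl⟩ := hA
    have hzU : z ∈ (U : Set E4) := hUsub ⟨hz0, hzin⟩
    have hrpos : 0 < Kerr.radius (a l) (poincareInv (mo l).1 (mo l).2 z) :=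
      hρpos.trans_le (hρ l)
    -- the reference background of hole `l` on the chart domain `U`
    let B : ModelBackground := ⟨U, boostedKerrBilin (mo l).1 (mo l).2 (M l) (a l), fun x ↦ x 0,
      fun x ↦ Kerr.radius (a l) (poincareInv (mo l).1 (mo l).2 x)⟩
    have hb : ContDiffAt ℝ ∞ B.bilin z :=
      contDiffAt_boostedKerrBilin (mo l).1 (mo l).2 (M l) (a l) hrpos
    have h1 : ContDiffAt ℝ m (𝒟.toSpacetime.deviationExtend B Φ) z :=
      (𝒟.toSpacetime.contDiffAt_deviationExtend_model B hΦs ⟨z, hzU⟩ hb).of_le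
        (by exact_mod_cast le_top)
    have h2 : ContDiffAt ℝ m
        (fun y ↦ boostedKerrBilin (mo l).1 (mo l).2 (M l) (a l) y - Minkowski.bilin) z :=
      contDiffAt_boostedKsPert hrpos
    have hev : 𝒟.toSpacetime.deviationExtend (Minkowski.backgroundOn U) Φ =ᶠ[𝓝 z] fun y ↦
        𝒟.toSpacetime.deviationExtend B Φ y +
          (boostedKerrBilin (mo l).1 (mo l).2 (M l) (a l) y - Minkowski.bilin) :=
      𝒟.toSpacetime.deviationExtend_backgroundOn_eventuallyEq_model B (W := U) le_rfl hΦs hzU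
    rw [(hev.iteratedFDeriv ℝ m).eq_of_nhds, fun_iteratedFDeriv_add_apply h1 h2]
    refine (norm_add_le _ _).trans (add_le_add ?_ ?_)
    · -- the near-disc certificate of hole `l` at `z ∈ Near_l`
      exact norm_iteratedFDeriv_le_of_supCkENorm_le hm hε (hnear l) ⟨hz0, hzin, by linarith⟩
    · -- the uniform decay `(G)` with the margins of hole `l`, at radius `r_l(z) ≥ ρ ≥ R₀`
      obtain ⟨hMl, hMu, hal, -, -, hΛl⟩ := hmarg l
      calc ‖iteratedFDeriv ℝ m
            (fun y ↦ boostedKerrBilin (mo l).1 (mo l).2 (M l) (a l) y - Minkowski.bilin) z‖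
          ≤ C / Kerr.radius (a l) (poincareInv (mo l).1 (mo l).2 z) :=
            hdec (M l) (a l) (mo l).1 (mo l).2 hMl hMu hal hΛl z (hρ₀.trans (hρ l)) m hm
        _ ≤ max C 0 / Kerr.radius (a l) (poincareInv (mo l).1 (mo l).2 z) :=
            div_le_div_of_nonneg_right (le_max_left _ _) hrpos.le
        _ ≤ max C 0 / ρ := div_le_div_of_nonneg_left hC0 hρpos (hρ l)

end Summit.FinalStateConjecture.FinalStateConjecture.Theorems.KerrnessPropagates.KerrBasinCapture
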